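import Summits.BirchSwinnertonDyer.BirchSwinnertonDyer.Theorems.ManinLocalTwoThreeTwentySevenA1Modular
import Literature.NumberTheory.EllipticCurves.ModularSymbolsProofs
import Literature.NumberTheory.NumberFields.EisensteinFieldPrimes
import HarnessLib

/-!
# The period lattice of `φ₂₇ = η(3τ)²η(9τ)²` is `ℤ[ω]`-stable: `ω · Λ(φ₂₇) ⊆ Λ(φ₂₇)` (an g49's (S1) `OmegaStableTwentySeven`), FACT-FREE
(route `ManinLocalTwoThree`, crux C3 `ManinPrimeToThreeAtNine` stmt-BirchSwinnertonDyer-22968; cell bsd-f2-manin, prover seat p3 gen 22; the first half of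
-an g49's «hexagonal squeeze» MEMO-an §94 — (S1) ∧ (S2) ⟹ `|c| = 1` at level `27` UNCONDITIONALLY; `--supports stmt-BirchSwinnertonDyer-22968`)

* §1 **`aₙ(φ₂₇) = 0` unless `n ≡ 1 (mod 3)`**: `aₙ(φ₂₇)` is the Hecke sum over ideals of `ℤ[ω]` of norm `n` PRIME TO `3` (p3+an `HeckeThetaTwentySeven`), and an
  ideal prime to `(3)` has norm `≡ 1 (mod 3)` (`absNorm_mod_three_of_isCoprime`: `N(a + bω) = a² − ab + b² ≡ (a + b)²`, and `3 ∣ N` would put the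
  generator in `(1 − ω) ⊇ (3)` — done by reduction mod `3` and `decide`).
* §2 **`ℰ_φ(τ + ⅓) = ω · ℰ_φ(τ)`**, `ω = e^{2πi/3}`: the Eichler integral is `Σ aₙ/n · qⁿ` (`hasSum_eichlerIntegral`) and `qⁿ(τ + ⅓) = ωⁿ qⁿ(τ) = ω qⁿ(τ)` on the
  support `n ≡ 1 (mod 3)`.
* §3 **`A = (1 ⅓; 0 1)` normalises `Γ₀(27)`**: for `γ = (a b; c d) ∈ Γ₀(27)` (so `27 ∣ c`, `a ≡ d (mod 3)`), `γ′ := (a + c/3, b + (d − a)/3 − c/9; c, d − c/3) ∈ Γ₀(27)`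
  and `γ′ • (τ + ⅓) = γ • τ + ⅓` (`exists_conj_oneThird`).
* §4 **(S1) `omegaStable_periodLattice_twentySeven : ∀ z ∈ Λ(φ₂₇), ω z ∈ Λ(φ₂₇)`**: `ω · {∞, γ∞} = ω(ℰ(γτ) − ℰ(τ)) = ℰ(γ′(τ+⅓)) − ℰ(τ+⅓) = {∞, γ′∞}`.

HONEST FRAMING: everything here is unconditional (standard axioms); it is one of the two inputs of -an g49's squeeze (the other, (S2) `Λ(φ₂₇) ⊆ Λ_{27a1}` via the
explicit `η`-certificate, is NOT proved here).  Nothing here computes a Manin constant or proves C3, Manin's conjecture or BSD; the items stay OPEN as filed.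
No definition (ω is spelled `Complex.exp (2 * π * I / 3)`), no named fact, no sorry.
[cite: Manin1972, Prop. 1.4 / §1.6 (periods and the Eichler integral)] [cite: IrelandRosen1990, Prop. 9.1.4] [cite: Koehler2011, §1] [cite: CremonaAlgorithms1997, §2.8]
-/

set_option autoImplicit false
-- lint-debt: the directory name repeats the summit name (sibling precedent `ManinLocalTwoThreeTwentySevenA1Modular.lean`)
set_option linter.dupNamespace false

noncomputable section

open scoped MatrixGroups ModularForm Topology Real
open Filter NumberField IsDedekindDomain Finset CongruenceSubgroup Complex Function
open UpperHalfPlane hiding I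
open Literature.NumberTheory.NumberFields Literature.NumberTheory.NumberFields.K3
open Literature.NumberTheory.LFunctions Literature.NumberTheory.LFunctions.NumberField
open Literature.NumberTheory.LFunctions.EisensteinGrossen
open Literature.NumberTheory.EllipticCurves Literature.NumberTheory.EllipticCurves.ModularForms

namespace Summit.BirchSwinnertonDyer.BirchSwinnertonDyer.Theorems.ManinLocalTwoThree.OmegaStableTwentySeven

/-! ## §1 The support of the coefficients of `φ₂₇` is `n ≡ 1 (mod 3)` -/

/-- Mod-`3` bookkeeping: if `(x + yω)(a + bω) + 3(s + tω) = 1` in `ℤ[ω]` then `3 ∤ a² − ab + b²`. [folklore] -/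
theorem norm_mod_three_ne_zero_of_coprime {a b x y s t : ℤ} (h1 : x * a - y * b + 3 * s = 1) (h2 : x * b + y * a - y * b + 3 * t = 0) :
    ¬ (3 : ℤ) ∣ a ^ 2 - a * b + b ^ 2 := by
  intro h3
  have key : ∀ a b x y : ZMod 3, a ^ 2 - a * b + b ^ 2 = 0 → x * b + y * a - y * b = 0 → x * a - y * b ≠ 1 := by decide
  refine key (a : ZMod 3) (b : ZMod 3) (x : ZMod 3) (y : ZMod 3) ?_ ?_ ?_
  · have := (ZMod.intCast_zmod_eq_zero_iff_dvd _ 3).mpr h3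
    push_cast at this
    exact this
  · have h := congrArg (fun z : ℤ ↦ (z : ZMod 3)) h2
    push_cast at h
    have h3z : (3 : ZMod 3) = 0 := by decide
    simpa [h3z] using h
  · have h := congrArg (fun z : ℤ ↦ (z : ZMod 3)) h1
    push_cast at h
    have h3z : (3 : ZMod 3) = 0 := by decide
    simpa [h3z] using h

/-- **An ideal of `ℤ[ω]` prime to `(3)` has norm `≡ 1 (mod 3)`** (`ℤ[ω]` is a PID; `N(a + bω) = a² − ab + b²` is never `≡ 2`, and is `≢ 0` by coprimality).
[cite: IrelandRosen1990, Prop. 9.1.4] -/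
theorem absNorm_mod_three_of_isCoprime {I : Ideal (𝓞 K3)} (hc : IsCoprime I three) : Ideal.absNorm I % 3 = 1 := by
  obtain ⟨α, hα⟩ := (IsPrincipalIdealRing.principal I).principal
  have hI : I = Ideal.span {α} := by rw [hα]
  obtain ⟨a, b, rfl⟩ := exists_eq_mkInt α
  rw [hI, absNorm_span_mkInt]
  have h2 := norm_int_emod_three_ne_two a b
  -- coprimality in coordinates
  have hc' : IsCoprime (mkInt a b) (3 : 𝓞 K3) := by
    rw [hI] at hc
    exact (Ideal.isCoprime_span_singleton_iff _ _).mp hc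
  obtain ⟨u, v, huv⟩ := hc'
  obtain ⟨x, y, rfl⟩ := exists_eq_mkInt u
  obtain ⟨s, t, rfl⟩ := exists_eq_mkInt v
  have hprod : mkInt x y * mkInt a b + mkInt s t * 3 = mkInt (x * a - y * b + 3 * s) (x * b + y * a - y * b + 3 * t) := by
    rw [mkInt_mul, show (3 : 𝓞 K3) = ((3 : ℤ) : 𝓞 K3) by norm_cast, ← mkInt_intCast, mkInt_mul, mkInt_add]
    congr 1 <;> ring
  rw [hprod, show (1 : 𝓞 K3) = mkInt 1 0 from by rw [show (1 : 𝓞 K3) = ((1 : ℤ) : 𝓞 K3) by norm_cast, ← mkInt_intCast]] at huv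
  have e1 : x * a - y * b + 3 * s = 1 := (mkInt_inj.mp huv).1
  have e2 : x * b + y * a - y * b + 3 * t = 0 := (mkInt_inj.mp huv).2
  have h0 := norm_mod_three_ne_zero_of_coprime e1 e2
  have hnn : 0 ≤ a ^ 2 - a * b + b ^ 2 := by nlinarith [sq_nonneg (a - b), sq_nonneg a, sq_nonneg b]
  have hnat : ((a ^ 2 - a * b + b ^ 2).natAbs : ℤ) = a ^ 2 - a * b + b ^ 2 := Int.natAbs_of_nonneg hnn
  omega

/-- **`aₙ(φ₂₇) = 0` unless `n ≡ 1 (mod 3)`** (the Hecke sum runs over ideals prime to `3`, whose norms are `≡ 1 (mod 3)`). UNCONDITIONAL.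
[cite: Koehler2011, §1] [cite: IrelandRosen1990, Ch. 18 §7] -/
theorem cuspCoeff_etaProductTwentySeven_eq_zero_of_mod_three_ne_one {n : ℕ} (hn : n % 3 ≠ 1) : cuspCoeff cuspFormEtaProductTwentySeven n = 0 := by
  rw [HeckeThetaTwentySeven.cuspCoeff_etaProductTwentySeven_eq_heckeSum]
  refine Finset.sum_eq_zero fun I hI ↦ ?_
  have hIn := mem_idealsOfNorm.mp hI
  rw [HeckeThetaTwentySeven.grossenNu_one_apply, if_neg, zero_mul]
  rw [HeckeThetaTwentySeven.adm_one_iff]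
  rintro ⟨-, hcop⟩
  have h := absNorm_mod_three_of_isCoprime hcop
  rw [hIn] at h
  exact hn h

/-! ## §2 `ℰ_φ(τ + ⅓) = ω · ℰ_φ(τ)` -/

/-- `ω³ = 1` for `ω = e^{2πi/3}`. [folklore] -/
theorem omega_pow_three : Complex.exp (2 * π * I / 3) ^ 3 = 1 := by
  rw [← Complex.exp_nat_mul, show ((3 : ℕ) : ℂ) * (2 * π * I / 3) = 2 * π * I by push_cast; ring, Complex.exp_two_pi_mul_I]

/-- `ωⁿ = ω` for `n ≡ 1 (mod 3)`. [folklore] -/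
theorem omega_pow_of_mod_three_eq_one {n : ℕ} (hn : n % 3 = 1) : Complex.exp (2 * π * I / 3) ^ n = Complex.exp (2 * π * I / 3) := by
  conv_lhs => rw [← Nat.div_add_mod n 3, hn, pow_add, pow_mul, omega_pow_three, one_pow, one_mul, pow_one]

/-- `q(τ + ⅓) = ω · q(τ)`. [folklore] -/
theorem qParam_vadd_oneThird (τ : ℍ) :
    Periodic.qParam 1 (((((1 : ℝ) / 3 : ℝ) +ᵥ τ) : ℍ) : ℂ) = Complex.exp (2 * π * I / 3) * Periodic.qParam 1 (τ : ℂ) := by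
  rw [UpperHalfPlane.coe_vadd, Periodic.qParam, Periodic.qParam, ← Complex.exp_add]
  congr 1
  push_cast
  ring

/-- **`ℰ_φ(τ + ⅓) = ω · ℰ_φ(τ)`** for the Eichler integral `ℰ_φ = 2πi ∫_{i∞}^τ φ₂₇ = Σ aₙ/n qⁿ` (only `n ≡ 1 (mod 3)` contribute). UNCONDITIONAL.
[cite: Manin1972, §1.6] [cite: CremonaAlgorithms1997, §2.8] -/
theorem eichlerIntegral_vadd_oneThird (τ : ℍ) :
    eichlerIntegral cuspFormEtaProductTwentySeven (((1 : ℝ) / 3 : ℝ) +ᵥ τ) =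
      Complex.exp (2 * π * I / 3) * eichlerIntegral cuspFormEtaProductTwentySeven τ := by
  have h1 := hasSum_eichlerIntegral cuspFormEtaProductTwentySeven (((1 : ℝ) / 3 : ℝ) +ᵥ τ)
  have h2 := (hasSum_eichlerIntegral cuspFormEtaProductTwentySeven τ).mul_left (Complex.exp (2 * π * I / 3))
  have hfun : (fun n : ℕ ↦ cuspCoeff cuspFormEtaProductTwentySeven n / n * Periodic.qParam 1 (((((1 : ℝ) / 3 : ℝ) +ᵥ τ) : ℍ) : ℂ) ^ n) =
      fun n : ℕ ↦ Complex.exp (2 * π * I / 3) * (cuspCoeff cuspFormEtaProductTwentySeven n / n * Periodic.qParam 1 (τ : ℂ) ^ n) := by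
    funext n
    rw [qParam_vadd_oneThird, mul_pow]
    by_cases hn : n % 3 = 1
    · rw [omega_pow_of_mod_three_eq_one hn]; ring
    · rw [cuspCoeff_etaProductTwentySeven_eq_zero_of_mod_three_ne_one hn]; simp
  rw [hfun] at h1
  exact h1.unique h2

/-! ## §3 `A = (1 ⅓; 0 1)` normalises `Γ₀(27)` -/

/-- **Conjugation by `(1 ⅓; 0 1)` preserves `Γ₀(27)`**: for `γ ∈ Γ₀(27)` there is `γ′ ∈ Γ₀(27)` with `γ′ • (τ + ⅓) = γ • τ + ⅓` for all `τ ∈ ℍ`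
(`γ′ = (a + c/3, b + (d − a)/3 − c/9; c, d − c/3)`; integral because `27 ∣ c` and `a ≡ d (mod 3)`). [cite: Manin1972, Prop. 1.4] -/
theorem exists_conj_oneThird (γ : Gamma0 27) :
    ∃ γ' : Gamma0 27, ∀ τ : ℍ, ((γ' : SL(2, ℤ)) • (((1 : ℝ) / 3 : ℝ) +ᵥ τ) : ℍ) = ((1 : ℝ) / 3 : ℝ) +ᵥ ((γ : SL(2, ℤ)) • τ) := by
  set a : ℤ := (γ : SL(2, ℤ)) 0 0 with ha
  set b : ℤ := (γ : SL(2, ℤ)) 0 1 with hb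
  set c : ℤ := (γ : SL(2, ℤ)) 1 0 with hc
  set d : ℤ := (γ : SL(2, ℤ)) 1 1 with hd
  have hdet : a * d - b * c = 1 := by
    have h := Matrix.det_fin_two ((γ : SL(2, ℤ)) : Matrix (Fin 2) (Fin 2) ℤ)
    rw [(γ : SL(2, ℤ)).det_coe] at h
    rw [ha, hb, hc, hd]; linarith
  have hc27 : (27 : ℤ) ∣ c := by
    have h := γ.2
    rw [Gamma0_mem] at h
    exact (ZMod.intCast_zmod_eq_zero_iff_dvd _ 27).mp h
  obtain ⟨k, hk⟩ := hc27
  have had : (3 : ℤ) ∣ d - a := by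
    have key : ∀ a d : ZMod 3, a * d = 1 → d - a = 0 := by decide
    have h1 : ((a : ZMod 3)) * (d : ZMod 3) = 1 := by
      have h := congrArg (fun z : ℤ ↦ (z : ZMod 3)) hdet
      rw [hk] at h
      push_cast at h
      have h27 : (27 : ZMod 3) = 0 := by decide
      simp only [h27, zero_mul, mul_zero, sub_zero] at h
      exact h
    have h2 := key _ _ h1
    have : (((d - a : ℤ)) : ZMod 3) = 0 := by push_cast; exact h2
    exact (ZMod.intCast_zmod_eq_zero_iff_dvd _ 3).mp this
  obtain ⟨m, hm⟩ := had
  -- the conjugated matrix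
  let M : Matrix (Fin 2) (Fin 2) ℤ := !![a + 9 * k, b + m - 3 * k; 27 * k, d - 9 * k]
  have hMdet : M.det = 1 := by
    rw [Matrix.det_fin_two_of]
    linear_combination hdet + b * hk + 9 * k * hm
  let γ'' : SL(2, ℤ) := ⟨M, hMdet⟩
  have hmem : γ'' ∈ Gamma0 27 := by
    rw [Gamma0_mem]
    exact (ZMod.intCast_zmod_eq_zero_iff_dvd _ 27).mpr ⟨k, rfl⟩
  refine ⟨⟨γ'', hmem⟩, fun τ ↦ ?_⟩
  -- non-vanishing of the denominator `cτ + d`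
  have hcd : (![((27 * k : ℤ) : ℝ), ((d : ℤ) : ℝ)] : Fin 2 → ℝ) ≠ 0 := by
    intro h
    have h0 := congrFun h 0
    have h1 := congrFun h 1
    simp only [Matrix.cons_val_zero, Matrix.cons_val_one, Pi.zero_apply, Int.cast_eq_zero] at h0 h1
    rw [hk, h0, h1] at hdet
    simp at hdet
  have hden := UpperHalfPlane.linear_ne_zero τ hcd
  simp only [Matrix.cons_val_zero, Matrix.cons_val_one, Complex.ofReal_intCast] at hden
  apply UpperHalfPlane.ext
  rw [UpperHalfPlane.coe_vadd, coe_specialLinearGroup_apply, coe_specialLinearGroup_apply]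
  have e00 : ((((⟨γ'', hmem⟩ : Gamma0 27) : SL(2, ℤ)) 0 0 : ℤ)) = a + 9 * k := rfl
  have e01 : ((((⟨γ'', hmem⟩ : Gamma0 27) : SL(2, ℤ)) 0 1 : ℤ)) = b + m - 3 * k := rfl
  have e10 : ((((⟨γ'', hmem⟩ : Gamma0 27) : SL(2, ℤ)) 1 0 : ℤ)) = 27 * k := rfl
  have e11 : ((((⟨γ'', hmem⟩ : Gamma0 27) : SL(2, ℤ)) 1 1 : ℤ)) = d - 9 * k := rfl
  rw [e00, e01, e10, e11, UpperHalfPlane.coe_vadd]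
  simp only [← ha, ← hb, ← hc, ← hd, hk, eq_intCast, Complex.ofReal_intCast]
  have hm' : (d : ℂ) - (a : ℂ) = 3 * (m : ℂ) := by exact_mod_cast hm
  have hden_eq : (((27 * k : ℤ)) : ℂ) * ((((1 : ℝ) / 3 : ℝ) : ℂ) + (τ : ℂ)) + ((d - 9 * k : ℤ) : ℂ) = ((27 * k : ℤ) : ℂ) * (τ : ℂ) + (d : ℂ) := by
    push_cast; ring
  have hnum_eq : (((a + 9 * k : ℤ)) : ℂ) * ((((1 : ℝ) / 3 : ℝ) : ℂ) + (τ : ℂ)) + ((b + m - 3 * k : ℤ) : ℂ) =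
      ((a : ℂ) * (τ : ℂ) + (b : ℂ)) + (((27 * k : ℤ) : ℂ) * (τ : ℂ) + (d : ℂ)) / 3 := by
    push_cast
    linear_combination (-(1 : ℂ) / 3) * hm'
  rw [hden_eq, hnum_eq, add_div, add_comm]
  congr 1
  push_cast at hden ⊢
  field_simp

/-! ## §4 (S1): `ω · Λ(φ₂₇) ⊆ Λ(φ₂₇)` -/

/-- **`ω · {∞, γ∞}_φ = {∞, γ′∞}_φ`** with `γ′ = AγA⁻¹ ∈ Γ₀(27)`: the period of `γ` rotated by `ω` is again a period. [cite: Manin1972, Prop. 1.4] -/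
theorem omega_mul_cuspSymbol_mem (γ : Gamma0 27) :
    Complex.exp (2 * π * I / 3) * cuspSymbol cuspFormEtaProductTwentySeven γ ∈ periodLattice cuspFormEtaProductTwentySeven := by
  obtain ⟨γ', hγ'⟩ := exists_conj_oneThird γ
  have h := eichlerIntegral_smul_sub_holds cuspFormEtaProductTwentySeven γ UpperHalfPlane.I
  have h' := eichlerIntegral_smul_sub_holds cuspFormEtaProductTwentySeven γ' (((1 : ℝ) / 3 : ℝ) +ᵥ UpperHalfPlane.I)
  rw [hγ' UpperHalfPlane.I, eichlerIntegral_vadd_oneThird, eichlerIntegral_vadd_oneThird, ← mul_sub, h] at h'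
  rw [h']
  exact AddSubgroup.subset_closure ⟨γ', rfl⟩

/-- **(S1) = -an g49's `OmegaStableTwentySeven`, PROVED: the period lattice of `φ₂₇ = η(3τ)²η(9τ)²` is stable under multiplication by `ω = e^{2πi/3}`**
(it is a `ℤ[ω]`-module: the CM of `X₀(27)`).  UNCONDITIONAL. [cite: Manin1972, Prop. 1.4 / §1.6] [cite: CremonaAlgorithms1997, §2.8] -/
theorem omegaStable_periodLattice_twentySeven :
    ∀ z ∈ periodLattice cuspFormEtaProductTwentySeven, Complex.exp (2 * π * I / 3) * z ∈ periodLattice cuspFormEtaProductTwentySeven := by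
  intro z hz
  induction hz using AddSubgroup.closure_induction with
  | mem x hx =>
    obtain ⟨γ, rfl⟩ := hx
    exact omega_mul_cuspSymbol_mem γ
  | zero => rw [mul_zero]; exact zero_mem _
  | add x y _ _ hx hy => rw [mul_add]; exact add_mem hx hy
  | neg x _ hx => rw [mul_neg]; exact neg_mem hx

/-- `ω² · Λ(φ₂₇) ⊆ Λ(φ₂₇)` as well (iterate), so `Λ(φ₂₇)` is a `ℤ[ω]`-submodule of `ℂ`. [cite: Manin1972, §1.6] -/
theorem omega_sq_mul_mem_periodLattice_twentySeven {z : ℂ} (hz : z ∈ periodLattice cuspFormEtaProductTwentySeven) :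
    Complex.exp (2 * π * I / 3) ^ 2 * z ∈ periodLattice cuspFormEtaProductTwentySeven := by
  rw [sq, mul_assoc]
  exact omegaStable_periodLattice_twentySeven _ (omegaStable_periodLattice_twentySeven z hz)

end Summit.BirchSwinnertonDyer.BirchSwinnertonDyer.Theorems.ManinLocalTwoThree.OmegaStableTwentySeven

end
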